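import Summits.QuantumFields.YangMills.Theorems.FluctuationComparisonRegPrIntLS2BetaSquareRadialProjection
import Summits.QuantumFields.YangMills.Theorems.FluctuationComparisonRegPrIntLS2BetaConeFilling
import HarnessLib

/-!
# (BG∞) ∕ `hsupp⁺` — (G7-T)-lattice, FILE T2 OF UV3-NODE §116.4: THE CONE ON A DISCRETE SQUARE — STAGE T ON ONE SLICE:
# boundary data `φ` on the ring of `{0..n}²`, a centre `a` off whose antipodal cap the data lie, `⟹` an explicit filling `W φ` with `W φ = φ` on the boundary, staying in the
# data's ball about `a`, lattice steps `≤ 3Λλ + 3(π−r)∕n` (`Λ = (π−r)∕sin r`, `λ` the data's `ℓ¹`-modulus on the boundary), and `W φ`, `W φ′` pointwise `Λμ`-close for `μ`-close data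

Cell `ym3-torus` (YM ladder rung R3 = continuum `SU(2)` Yang–Mills on the three-torus at fixed lattice data — a RUNG: NOT d = 4, NOT infinite volume, NOT a mass gap,
NOT Clay).  Width seat «width 5» `ym3-torus-px5` (gen 24), FREE px helper on crux `stmt-QuantumFields-20520` (`…Theses.UnitScaleTilt.FluctuationComparisonRegPrIntL`);
`--kind proof --supports stmt-QuantumFields-20520 --as helper`, count-neutral, DEFINITION-FREE (0 `def`, 0 `instance`, 0 `notation`, 0 `sorry`; default heartbeats; BINDER
STYLE per desk RULING №127: the filling is an ∃-witnessed OPERATOR `W : (ℕ × ℕ → SU2) → (ℕ × ℕ → SU2)` with its laws as conjuncts).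

WHY (architect-lineage RULING «(BG∞) PLAN OF RECORD = UV3-NODE §116» 2026-09-01 00:13:02Z; px19 g25 01:09:19Z (3) «(G7-T∕S)-lattice … yours»; MINE 01:12:03Z).  Stage T of the
8-colour gluing (px19 g25 §116.3): a class-110 block sees prescribed data on the four closed faces around its even axis — a discrete TUBE `∂□ × [0, ℓ]` — and is filled
SLICE BY SLICE by coning the ring data of each slice `∂□ × {h}` toward a centre `a` that the whole tube image misses by arc `r` (✓p838983-class `exists_coneCentre_of_patched`
over ✓p838857 (G4)).  The index-free cone is ✓p839271 `…ConeFilling` (px19); the square's geometry is FILE T1 ✓∕⧗`…SquareRadialProjection` (this seat: depth, proportional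
projection, distortion law).  THIS FILE puts them together: `W φ (i, j) := a · expPoint ((1 − dep∕n′) • logVec (a⁻¹ · φ (pr i j)))`, `n′ := n∕2`.  The tangential step at
depth `k` is `(1 − k∕n′)·Λ·dist1(data at the two projections) ≤ (1 − k∕n′)·Λ·λ·|Δpr|₁ ≤ Λλ·n∕n′ ≤ 3Λλ` by T1's law `(n′ − max k)·|Δpr|₁ ≤ n`; a change of depth adds one
radial step `(π−r)∕n′ ≤ 3(π−r)∕n` through the DEEPER level (whose factor vanishes at the apex); slices with pointwise `μ`-close data give pointwise `Λμ`-close fillings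
(the tube's axial bonds).

WHAT IS PROVED (sorry-free).  ★★★ `exists_coneOnSquare (n) (hn : 2 ≤ n) (hr : 0 < r) (hrπ : r < π) (a : SU2) : ∃ W : (ℕ × ℕ → SU2) → (ℕ × ℕ → SU2), ∀ φ,`
`(CAP: every boundary datum within arc π − r of a) →` (i) `W φ = φ` on the boundary ring; (ii) `‖logVec (a⁻¹ · W φ (i,j))‖ ≤ π − r` on the square; (iii) for every `λ ≥ 0` with the
`ℓ¹`-MODULUS `dist1 (φ P · (φ Q)⁻¹) ≤ λ·(Nat.dist P.1 Q.1 + Nat.dist P.2 Q.2)` on boundary pairs: horizontal and vertical lattice steps of `W φ` in the square are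
`≤ 3·((π−r)∕sin r)·λ + 3·(π−r)∕n`; (iv) for a second datum `φ′` with the cap and `dist1 (φ P · (φ′ P)⁻¹) ≤ μ` on the boundary: `dist1 (W φ (i,j) · (W φ′ (i,j))⁻¹) ≤ ((π−r)∕sin r)·μ`
on the square.  Helpers: `one_div_half_le` (`1∕n′ ≤ 3∕n`), `depthFactor_mul_le` (the real form of T1's law), `cone_step_core` (the three-case step estimate for abstract depths
`|kx − ky| ≤ 1` and data `qx, qy`).

DOMAIN SENTENCE (RULING №115 R5).  One square, any `n ≥ 2`, any centre and data under the cap hypothesis; the `ℓ¹`-modulus form of the data regularity is a HYPOTHESIS (from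
per-bond ring-Lipschitz `λ₀` it follows with `λ = 2λ₀` — ring distance ≤ twice `ℓ¹` distance — a separate XS∕S lemma T0, not in this file); the identification of the square
with a slice of a class-110 block and of `φ` with the tube data is (G6)∕(G8)'s binder bookkeeping (px19).  (G7-S) (the shell, one dimension up) OPEN.

HONEST SCOPE.  [folklore] discrete coning assembled from landed pieces; `hsupp⁺`∕`hBG` is a CONJECTURE with a plan (§116) and numerics (FL-39∕40), NOT proved; nothing of
Bałaban's renormalisation-group analysis asserted or proved ([Balaban1985RegularSpaces] (1.29) p.81, Thm 2 p.83 — the printed LOCAL gauges this road globalises); `hsupp^{≥J₀}`,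
hD, hDBX, h3 HYPOTHESES; GAP♯∘ (registry v11 3732b7df; v12.1 adopted-in-waiting), the five registered stubs (0∕5), S2β, 20520, 19936, 19200, `YM3TorusSU2` NOT proved; no
registered stub closed; rung R3 — NOT d = 4, NOT infinite volume, NOT a mass gap, NOT Clay; the Yang–Mills mass gap is NOT proved.
-/

set_option autoImplicit false

noncomputable section

namespace Summit.QuantumFields.YangMills.Theorems.FluctuationComparisonRegPrIntLS2BetaConeOnSquare

open scoped Real
open Literature.MathematicalPhysics.QuantumLattice (su2Quat)
open Literature.MathematicalPhysics.QuantumFieldTheory.Balaban1983to89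
open T4CubeChartGnomonic (SU2)
open T4HaarSU2ExpChart (expPoint)
open T4ExpWindowSmallField (logVec norm_logVec_le_pi)
open Summit.QuantumFields.YangMills.Theorems.FluctuationComparisonRegPrIntLS2BetaSquareRadialProjection (exists_squareProjection)
open Summit.QuantumFields.YangMills.Theorems.FluctuationComparisonRegPrIntLS2BetaConeFilling
  (coneFill_zero norm_logVec_inv_mul_coneFill_le dist1_coneFill_radial_le dist1_coneFill_tangential_le dist1_mul_inv_le_via)

/-! ## §1 Arithmetic of the depth factor -/

/-- `n′ := n ∕ 2` satisfies `1∕n′ ≤ 3∕n` for `n ≥ 2`. [folklore] -/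
theorem one_div_half_le (n : ℕ) (hn : 2 ≤ n) : (1 : ℝ) / (n / 2 : ℕ) ≤ 3 / n := by
  have h2 : 1 ≤ n / 2 := by omega
  have h3 : n ≤ 3 * (n / 2) := by omega
  have hn' : (0 : ℝ) < ((n / 2 : ℕ) : ℝ) := by exact_mod_cast h2
  have hn0 : (0 : ℝ) < n := by exact_mod_cast (show 0 < n by omega)
  rw [div_le_div_iff₀ hn' hn0, one_mul]
  exact_mod_cast h3

/-- ★ **THE DEPTH FACTOR IN REAL FORM**: from T1's law `(n′ − k)·D ≤ n` (`k ≤ n′`, `1 ≤ n′`), `(1 − k∕n′)·D ≤ n∕n′`. [folklore] -/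
theorem depthFactor_mul_le {n' k D n : ℕ} (hn' : 1 ≤ n') (hk : k ≤ n') (h : (n' - k) * D ≤ n) :
    (1 - (k : ℝ) / n') * (D : ℝ) ≤ (n : ℝ) / n' := by
  have hn0 : (0 : ℝ) < n' := by exact_mod_cast hn'
  have hcast : (((n' - k) * D : ℕ) : ℝ) ≤ n := by exact_mod_cast h
  rw [Nat.cast_mul, Nat.cast_sub hk] at hcast
  rw [show (1 - (k : ℝ) / n') * (D : ℝ) = (((n' : ℝ) - k) * D) / n' by field_simp, div_le_div_iff_of_pos_right hn0]
  exact hcast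

/-! ## §2 The three-case step estimate for abstract depths -/

/-- ★★ **THE CORE STEP WITH A DISTORTION CONSTANT `c`** (dimension-free: the square has `c = 1` (T1 ✓p839691), the cube `c = 2` ((G7-S) S1, px8)): two cone points `w(qx, kx)`, `w(qy, ky)` (`kx, ky ≤ n′`, `|kx − ky| ≤ 1`, data off the cap of `a`) whose data are `λ·D`-close with
`(n′ − max kx ky)·D ≤ c·n` are within `3cΛλ + 3(π−r)∕n`: at equal depth the tangential bound; otherwise one radial step through the deeper level plus the tangential bound there. [folklore] -/
theorem cone_step_core_mul {n : ℕ} (hn : 2 ≤ n) {r : ℝ} (hr : 0 < r) (hrπ : r < π) (a qx qy : SU2)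
    (hqx : ‖logVec (su2Quat (a⁻¹ * qx))‖ ≤ π - r) (hqy : ‖logVec (su2Quat (a⁻¹ * qy))‖ ≤ π - r)
    {kx ky : ℕ} (hkx : kx ≤ n / 2) (hky : ky ≤ n / 2) (hkk : ky = kx ∨ ky = kx + 1 ∨ kx = ky + 1)
    {lam : ℝ} (hlam : 0 ≤ lam) {D : ℕ} (hD : dist1 (qx * qy⁻¹) ≤ lam * D) (c : ℕ) (hdist : (n / 2 - max kx ky) * D ≤ c * n) :
    dist1 (a * expPoint ((1 - (kx : ℝ) / (n / 2 : ℕ)) • logVec (su2Quat (a⁻¹ * qx))) *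
        (a * expPoint ((1 - (ky : ℝ) / (n / 2 : ℕ)) • logVec (su2Quat (a⁻¹ * qy))))⁻¹) ≤
      3 * c * ((π - r) / Real.sin r) * lam + 3 * (π - r) / n := by
  have hn' : 1 ≤ n / 2 := by omega
  have hn'0 : 0 < n / 2 := hn'
  have hΛ0 : 0 ≤ (π - r) / Real.sin r := div_nonneg (by linarith) (Real.sin_nonneg_of_nonneg_of_le_pi hr.le hrπ.le)
  have hπr : 0 ≤ π - r := by linarith
  have h3 : (1 : ℝ) / (n / 2 : ℕ) ≤ 3 / n := one_div_half_le n hn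
  have hnn : (n : ℝ) / (n / 2 : ℕ) ≤ 3 := by
    have hn0 : (0 : ℝ) < n := by exact_mod_cast (show 0 < n by omega)
    have := mul_le_mul_of_nonneg_left h3 hn0.le
    rwa [mul_one_div, mul_div_assoc', mul_comm (n : ℝ) 3, mul_div_assoc, div_self hn0.ne', mul_one] at this
  have hc0 : (0 : ℝ) ≤ c := Nat.cast_nonneg _
  have hcn : (((c * n : ℕ) : ℝ)) / (n / 2 : ℕ) ≤ 3 * c := by
    rw [Nat.cast_mul, mul_div_assoc]
    calc (c : ℝ) * ((n : ℝ) / (n / 2 : ℕ)) ≤ c * 3 := mul_le_mul_of_nonneg_left hnn hc0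
      _ = 3 * c := mul_comm _ _
  -- the tangential bound at a depth `k ≤ n′` with `(n′ − k)·D ≤ c·n`: `≤ 3cΛλ`
  have tang : ∀ k, k ≤ n / 2 → (n / 2 - k) * D ≤ c * n →
      dist1 (a * expPoint ((1 - (k : ℝ) / (n / 2 : ℕ)) • logVec (su2Quat (a⁻¹ * qx))) *
          (a * expPoint ((1 - (k : ℝ) / (n / 2 : ℕ)) • logVec (su2Quat (a⁻¹ * qy))))⁻¹) ≤ 3 * c * ((π - r) / Real.sin r) * lam := by
    intro k hk hkD
    have h1 := dist1_coneFill_tangential_le hr hrπ a qx qy hqx hqy (n := n / 2) hk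
    have hfac := depthFactor_mul_le hn' hk hkD
    have hk1 : 0 ≤ 1 - (k : ℝ) / (n / 2 : ℕ) := by
      rw [sub_nonneg, div_le_one (by exact_mod_cast hn'0)]; exact_mod_cast hk
    calc _ ≤ (1 - (k : ℝ) / (n / 2 : ℕ)) * ((π - r) / Real.sin r) * dist1 (qx * qy⁻¹) := h1
      _ ≤ (1 - (k : ℝ) / (n / 2 : ℕ)) * ((π - r) / Real.sin r) * (lam * D) := mul_le_mul_of_nonneg_left hD (mul_nonneg hk1 hΛ0)
      _ = ((π - r) / Real.sin r) * lam * ((1 - (k : ℝ) / (n / 2 : ℕ)) * (D : ℝ)) := by ring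
      _ ≤ ((π - r) / Real.sin r) * lam * ((((c * n : ℕ) : ℝ)) / (n / 2 : ℕ)) := mul_le_mul_of_nonneg_left hfac (mul_nonneg hΛ0 hlam)
      _ ≤ ((π - r) / Real.sin r) * lam * (3 * c) := mul_le_mul_of_nonneg_left hcn (mul_nonneg hΛ0 hlam)
      _ = 3 * c * ((π - r) / Real.sin r) * lam := by ring
  -- the radial bound `(π−r)∕n′ ≤ 3(π−r)∕n`
  have rad : (π - r) / (n / 2 : ℕ) ≤ 3 * (π - r) / n :=
    calc (π - r) / (n / 2 : ℕ) = (π - r) * (1 / (n / 2 : ℕ)) := by ring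
      _ ≤ (π - r) * (3 / n) := mul_le_mul_of_nonneg_left h3 hπr
      _ = 3 * (π - r) / n := by ring
  have hpos : 0 ≤ 3 * (π - r) / n := div_nonneg (by positivity) (Nat.cast_nonneg _)
  rcases hkk with h | h | h
  · -- equal depth
    rw [h] at hdist ⊢
    rw [max_self] at hdist
    exact (tang kx hkx hdist).trans (le_add_of_nonneg_right hpos)
  · -- `y` one level deeper: radially from `w(qx,kx)` to `w(qx,kx+1)`, then tangentially at depth `kx+1`
    rw [h] at hdist hky ⊢
    rw [max_eq_right (Nat.le_succ _)] at hdist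
    have hradial := (dist1_coneFill_radial_le a qx hn'0 kx hqx).trans rad
    have ht := tang (kx + 1) hky hdist
    exact (dist1_mul_inv_le_via _ (a * expPoint ((1 - ((kx + 1 : ℕ) : ℝ) / (n / 2 : ℕ)) • logVec (su2Quat (a⁻¹ * qx)))) _).trans
      ((add_le_add hradial ht).trans (le_of_eq (add_comm _ _)))
  · -- `x` one level deeper: tangentially at depth `kx = ky + 1`, then radially from `w(qy,ky+1)` back to `w(qy,ky)`
    rw [h] at hdist hkx ⊢
    rw [max_eq_left (Nat.le_succ _)] at hdist
    have ht := tang (ky + 1) hkx hdist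
    have hradial : dist1 (a * expPoint ((1 - ((ky + 1 : ℕ) : ℝ) / (n / 2 : ℕ)) • logVec (su2Quat (a⁻¹ * qy))) *
        (a * expPoint ((1 - (ky : ℝ) / (n / 2 : ℕ)) • logVec (su2Quat (a⁻¹ * qy))))⁻¹) ≤ 3 * (π - r) / n := by
      rw [← GaugeGroup.dist1_inv, mul_inv_rev, inv_inv]
      exact (dist1_coneFill_radial_le a qy hn'0 ky hqy).trans rad
    exact (dist1_mul_inv_le_via _ (a * expPoint ((1 - ((ky + 1 : ℕ) : ℝ) / (n / 2 : ℕ)) • logVec (su2Quat (a⁻¹ * qy)))) _).trans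
      (add_le_add ht hradial)

/-- ★★ **THE CORE STEP** (`c = 1`): two cone points `w(qx, kx)`, `w(qy, ky)` (`kx, ky ≤ n′`, `|kx − ky| ≤ 1`, data off the cap of `a`) whose data are `λ·D`-close with
`(n′ − max kx ky)·D ≤ n` are within `3Λλ + 3(π−r)∕n`: at equal depth the tangential bound; otherwise one radial step through the deeper level plus the tangential bound there. [folklore] -/
theorem cone_step_core {n : ℕ} (hn : 2 ≤ n) {r : ℝ} (hr : 0 < r) (hrπ : r < π) (a qx qy : SU2)
    (hqx : ‖logVec (su2Quat (a⁻¹ * qx))‖ ≤ π - r) (hqy : ‖logVec (su2Quat (a⁻¹ * qy))‖ ≤ π - r)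
    {kx ky : ℕ} (hkx : kx ≤ n / 2) (hky : ky ≤ n / 2) (hkk : ky = kx ∨ ky = kx + 1 ∨ kx = ky + 1)
    {lam : ℝ} (hlam : 0 ≤ lam) {D : ℕ} (hD : dist1 (qx * qy⁻¹) ≤ lam * D) (hdist : (n / 2 - max kx ky) * D ≤ n) :
    dist1 (a * expPoint ((1 - (kx : ℝ) / (n / 2 : ℕ)) • logVec (su2Quat (a⁻¹ * qx))) *
        (a * expPoint ((1 - (ky : ℝ) / (n / 2 : ℕ)) • logVec (su2Quat (a⁻¹ * qy))))⁻¹) ≤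
      3 * ((π - r) / Real.sin r) * lam + 3 * (π - r) / n := by
  have h := cone_step_core_mul hn hr hrπ a qx qy hqx hqy hkx hky hkk hlam hD 1 (by rwa [one_mul])
  simpa only [Nat.cast_one, mul_one] using h

/-! ## §3 The cone on the square -/

/-- ★★★ **THE CONE ON A DISCRETE SQUARE (STAGE T ON ONE SLICE)**: for `n ≥ 2`, `0 < r < π` and a centre `a` there is an OPERATOR `W` on data `φ : ℕ × ℕ → SU2` such that for
every `φ` whose boundary values lie within arc `π − r` of `a`: (i) `W φ = φ` on the boundary ring, (ii) `W φ` stays within arc `π − r` of `a` on the square, (iii) for every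
`λ ≥ 0` controlling the data's `ℓ¹`-modulus on the boundary, the horizontal and vertical lattice steps of `W φ` are `≤ 3·((π−r)∕sin r)·λ + 3·(π−r)∕n`, and (iv) two data
pointwise `μ`-close on the boundary have fillings pointwise `((π−r)∕sin r)·μ`-close (the tube's axial bonds).  `W φ (i,j) := a · expPoint ((1 − dep∕(n∕2)) • logVec (a⁻¹ · φ (pr i j)))`
over T1's `dep`, `pr`. [cite: Balaban1985RegularSpaces, Thm 2 p.83] -/
theorem exists_coneOnSquare (n : ℕ) (hn : 2 ≤ n) {r : ℝ} (hr : 0 < r) (hrπ : r < π) (a : SU2) :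
    ∃ W : (ℕ × ℕ → SU2) → (ℕ × ℕ → SU2), ∀ φ : ℕ × ℕ → SU2,
      (∀ i j, i ≤ n → j ≤ n → (i = 0 ∨ i = n ∨ j = 0 ∨ j = n) → ‖logVec (su2Quat (a⁻¹ * φ (i, j)))‖ ≤ π - r) →
      (∀ i j, i ≤ n → j ≤ n → (i = 0 ∨ i = n ∨ j = 0 ∨ j = n) → W φ (i, j) = φ (i, j)) ∧
      (∀ i j, i ≤ n → j ≤ n → ‖logVec (su2Quat (a⁻¹ * W φ (i, j)))‖ ≤ π - r) ∧
      (∀ lam : ℝ, 0 ≤ lam →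
        (∀ P Q : ℕ × ℕ, P.1 ≤ n → P.2 ≤ n → (P.1 = 0 ∨ P.1 = n ∨ P.2 = 0 ∨ P.2 = n) →
          Q.1 ≤ n → Q.2 ≤ n → (Q.1 = 0 ∨ Q.1 = n ∨ Q.2 = 0 ∨ Q.2 = n) →
          dist1 (φ P * (φ Q)⁻¹) ≤ lam * ((Nat.dist P.1 Q.1 + Nat.dist P.2 Q.2 : ℕ) : ℝ)) →
        (∀ i j, i + 1 ≤ n → j ≤ n → dist1 (W φ (i, j) * (W φ (i + 1, j))⁻¹) ≤ 3 * ((π - r) / Real.sin r) * lam + 3 * (π - r) / n) ∧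
        (∀ i j, i ≤ n → j + 1 ≤ n → dist1 (W φ (i, j) * (W φ (i, j + 1))⁻¹) ≤ 3 * ((π - r) / Real.sin r) * lam + 3 * (π - r) / n)) ∧
      (∀ φ' : ℕ × ℕ → SU2, ∀ μ : ℝ,
        (∀ i j, i ≤ n → j ≤ n → (i = 0 ∨ i = n ∨ j = 0 ∨ j = n) → ‖logVec (su2Quat (a⁻¹ * φ' (i, j)))‖ ≤ π - r) →
        (∀ i j, i ≤ n → j ≤ n → (i = 0 ∨ i = n ∨ j = 0 ∨ j = n) → dist1 (φ (i, j) * (φ' (i, j))⁻¹) ≤ μ) →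
        ∀ i j, i ≤ n → j ≤ n → dist1 (W φ (i, j) * (W φ' (i, j))⁻¹) ≤ ((π - r) / Real.sin r) * μ) := by
  obtain ⟨dep, pr, -, hdephalf, hdep0, hprb, hprid, hdepi, hdepj, hdisti, hdistj⟩ := exists_squareProjection n hn
  have hn' : 1 ≤ n / 2 := by omega
  have hΛ0 : 0 ≤ (π - r) / Real.sin r := div_nonneg (by linarith) (Real.sin_nonneg_of_nonneg_of_le_pi hr.le hrπ.le)
  refine ⟨fun φ x => a * expPoint ((1 - (dep x.1 x.2 : ℝ) / (n / 2 : ℕ)) • logVec (su2Quat (a⁻¹ * φ (pr x.1 x.2)))), fun φ hcap => ?_⟩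
  -- the datum read at the projection is a boundary datum, hence off the cap
  have hq : ∀ i j, i ≤ n → j ≤ n → ‖logVec (su2Quat (a⁻¹ * φ (pr i j)))‖ ≤ π - r := by
    intro i j hi hj
    obtain ⟨hb, h1, h2⟩ := hprb i j hi hj
    have := hcap (pr i j).1 (pr i j).2 h1 h2 hb
    exact this
  refine ⟨fun i j hi hj hb => ?_, fun i j hi hj => ?_, fun lam hlam hmod => ⟨fun i j hi hj => ?_, fun i j hi hj => ?_⟩, fun φ' μ hcap' hclose i j hi hj => ?_⟩
  · -- (i) boundary: depth `0`, projection the identity, cone parameter `1`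
    have h0 : dep i j = 0 := (hdep0 i j hi hj).2 hb
    show a * expPoint ((1 - (dep i j : ℝ) / (n / 2 : ℕ)) • logVec (su2Quat (a⁻¹ * φ (pr i j)))) = φ (i, j)
    rw [hprid i j hi hj hb, h0]
    exact coneFill_zero a (φ (i, j)) (n / 2)
  · -- (ii) position
    exact norm_logVec_inv_mul_coneFill_le a _ (hdephalf i j hi hj) (hq i j hi hj)
  · -- (iii) horizontal step
    have hi' : i ≤ n := by omega
    obtain ⟨hbx, hx1, hx2⟩ := hprb i j hi' hj
    obtain ⟨hby, hy1, hy2⟩ := hprb (i + 1) j hi hj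
    have hkk : dep (i + 1) j = dep i j ∨ dep (i + 1) j = dep i j + 1 ∨ dep i j = dep (i + 1) j + 1 := by
      have := hdepi i j; omega
    exact cone_step_core hn hr hrπ a _ _ (hq i j hi' hj) (hq (i + 1) j hi hj) (hdephalf i j hi' hj) (hdephalf (i + 1) j hi hj) hkk hlam
      (hmod (pr i j) (pr (i + 1) j) hx1 hx2 hbx hy1 hy2 hby) (hdisti i j hi hj)
  · -- (iii) vertical step
    have hj' : j ≤ n := by omega
    obtain ⟨hbx, hx1, hx2⟩ := hprb i j hi hj'
    obtain ⟨hby, hy1, hy2⟩ := hprb i (j + 1) hi hj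
    have hkk : dep i (j + 1) = dep i j ∨ dep i (j + 1) = dep i j + 1 ∨ dep i j = dep i (j + 1) + 1 := by
      have := hdepj i j; omega
    exact cone_step_core hn hr hrπ a _ _ (hq i j hi hj') (hq i (j + 1) hi hj) (hdephalf i j hi hj') (hdephalf i (j + 1) hi hj) hkk hlam
      (hmod (pr i j) (pr i (j + 1)) hx1 hx2 hbx hy1 hy2 hby) (hdistj i j hi hj)
  · -- (iv) slice to slice: same depth, same projection, data `μ`-close there
    obtain ⟨hb, h1, h2⟩ := hprb i j hi hj
    have hq' : ‖logVec (su2Quat (a⁻¹ * φ' (pr i j)))‖ ≤ π - r := hcap' (pr i j).1 (pr i j).2 h1 h2 hb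
    have ht := dist1_coneFill_tangential_le hr hrπ a (φ (pr i j)) (φ' (pr i j)) (hq i j hi hj) hq' (n := n / 2) (hdephalf i j hi hj)
    have hk1 : 1 - (dep i j : ℝ) / (n / 2 : ℕ) ≤ 1 := by
      have : 0 ≤ (dep i j : ℝ) / (n / 2 : ℕ) := by positivity
      linarith
    have hμ : dist1 (φ (pr i j) * (φ' (pr i j))⁻¹) ≤ μ := hclose (pr i j).1 (pr i j).2 h1 h2 hb
    have hμ0 : 0 ≤ μ := (GaugeGroup.dist1_nonneg _).trans hμ
    calc _ ≤ (1 - (dep i j : ℝ) / (n / 2 : ℕ)) * ((π - r) / Real.sin r) * dist1 (φ (pr i j) * (φ' (pr i j))⁻¹) := ht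
      _ ≤ 1 * ((π - r) / Real.sin r) * μ := by
          apply mul_le_mul (mul_le_mul_of_nonneg_right hk1 hΛ0) hμ (GaugeGroup.dist1_nonneg _) (mul_nonneg zero_le_one hΛ0)
      _ = (π - r) / Real.sin r * μ := by rw [one_mul]

end Summit.QuantumFields.YangMills.Theorems.FluctuationComparisonRegPrIntLS2BetaConeOnSquare

end
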